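import Summits.AtomisticToContinuum.Crystallization.Theorems.ExcessDecayLiouvilleCaccioppoliLocal
import Summits.AtomisticToContinuum.Crystallization.Theorems.ExcessDecayLiouvilleAffineFieldsBasic

/-!
# Route `ExcessDecayLiouville`: the localised Caccioppoli bound with an `ℓ²` TAIL term

Refinement of `abs_cutoffForm_le_local` (file `ExcessDecayLiouvilleCaccioppoliLocal.lean`) for the multi-scale
(Campanato) iteration of item `ExcessDecay` (stmt-AtomisticToContinuum-9334), harmonic-replacement architecture:
the far-field contribution is no longer bounded through the GLOBAL sup `B` of the displacement but kept as the
`ℓ²`-weighted tail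
`TT(h; c, R, ρ) = Σ'_p Σ'_q [p≠q][ρ < |p−q|] |p−q|⁻⁸ 𝟙[dist p c ≤ R] ‖h q‖²`,
which the iteration controls through the decay profile of `h` at larger scales.  For a finitely supported `h`,
a cutoff `η` with values in `[0,1]`, slope `1/ρ` between sites (`ρ ≥ 1`) and `η = 0` at the sites with
`dist · c > R`:

`|½ Σ'Σ' [p≠q] (η_p − η_q)² ⟪K(p−q) h_p, h_q⟫| ≤ (19·C₆/ρ²) M(R+ρ) + 19·F₈(ρ)·M(R) + 19·TT(h; c, R, ρ)`

(`abs_cutoffForm_le_tail`; `M(r) = Σ'_p ‖h p‖² 𝟙[dist p c ≤ r]`, `C₆ = 1024/(23/25)⁶`, `F₈(ρ) = 1024/((23/25)³ρ⁵)`),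
whence the Caccioppoli inequality `caccioppoli_l2_tail` and the gradient estimate along a lattice period
`gradient_estimate_tail_of_cutoff_of_dom`.  All `[folklore]`; helper lemmas, nothing here closes an item.
-/

noncomputable section

namespace Summit.AtomisticToContinuum.Crystallization.Theorems.ExcessDecayLiouville

open scoped BigOperators Topology InnerProductSpace RealInnerProductSpace Classical
open Literature.MathematicalPhysics.StatisticalMechanics
open Summit.AtomisticToContinuum.Crystallization.Theorems.PhononStabilityNegative

-- Local notation: the force-constant map `K(e)w = h(|e|²)w + 2⟪e,w⟫h′(|e|²)e`.
local notation3 "𝕂[" e "] " w:max =>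
  (-((‖e‖ ^ 2)⁻¹) ^ 7 + ((‖e‖ ^ 2)⁻¹) ^ 4) • w + (2 * ⟪e, w⟫ * (7 * ((‖e‖ ^ 2)⁻¹) ^ 8 - 4 * ((‖e‖ ^ 2)⁻¹) ^ 5)) • e
-- indicator of a closed ball and the far inverse-power weight
set_option quotPrecheck false in
local notation "𝟙ᵇ[" x ", " c ", " R "]" => (if dist (x : EuclideanSpace ℝ (Fin 3)) c ≤ R then (1 : ℝ) else 0)
set_option quotPrecheck false in
local notation "𝔣[" ρ ", " p ", " q "]" =>
  (if ρ < dist (p : EuclideanSpace ℝ (Fin 3)) q then (dist (p : EuclideanSpace ℝ (Fin 3)) q)⁻¹ ^ 8 else (0 : ℝ))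

section

variable {t : Fin 2 → (EuclideanSpace ℝ (Fin 3))} {A : (EuclideanSpace ℝ (Fin 3)) →L[ℝ] (EuclideanSpace ℝ (Fin 3))}

set_option quotPrecheck false in
-- Local notation: the operator row `(L v)(p)`.
local notation "𝕃" v:max " @ " p:max =>
  tsum (fun q : Sites₀ t A => (if ((p : Sites₀ t A) : EuclideanSpace ℝ (Fin 3)) ≠ q then
    𝕂[((p : Sites₀ t A) : EuclideanSpace ℝ (Fin 3)) - q] (v ((p : Sites₀ t A) : EuclideanSpace ℝ (Fin 3)) - v q) else 0))

/-! ## The two far families: local mass and tail -/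

/-- The far family with the LOCAL mass, `[p≠q] far(p,q) 𝟙_R(p) ‖h p‖²`, is summable on `S × S`. [folklore] -/
theorem summable_farMass (hA : Adm₀ A) (hI : Inner₀ t A) {h : (EuclideanSpace ℝ (Fin 3)) → (EuclideanSpace ℝ (Fin 3))}
    {B : ℝ} (hB : ∀ x, ‖h x‖ ≤ B) (c : (EuclideanSpace ℝ (Fin 3))) (R : ℝ) {ρ : ℝ} (hρ : 23 / 25 ≤ ρ) :
    Summable (Function.uncurry fun (p q : Sites₀ t A) => (if (p : (EuclideanSpace ℝ (Fin 3))) ≠ q then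
      𝔣[ρ, p, q] * 𝟙ᵇ[p, c, R] * ‖h p‖ ^ 2 else 0)) := by
  have hB0 : 0 ≤ B := (norm_nonneg _).trans (hB 0)
  have hW := (summable_farWeight hA hI c R hρ).mul_left (B ^ 2)
  refine Summable.of_nonneg_of_le (fun pq => ?_) (fun pq => ?_) hW
  · obtain ⟨p, q⟩ := pq
    simp only [Function.uncurry_apply_pair]
    split_ifs <;> positivity
  · obtain ⟨p, q⟩ := pq
    simp only [Function.uncurry_apply_pair]
    by_cases hpq : (p : (EuclideanSpace ℝ (Fin 3))) = q
    · simp [hpq]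
    · rw [if_pos hpq, if_pos hpq]
      have h0 : 0 ≤ 𝔣[ρ, p, q] * 𝟙ᵇ[p, c, R] := by
        have : (0 : ℝ) ≤ 𝔣[ρ, p, q] := by split_ifs <;> positivity
        have : (0 : ℝ) ≤ 𝟙ᵇ[p, c, R] := by split_ifs <;> norm_num
        positivity
      have hh2 : ‖h p‖ ^ 2 ≤ B ^ 2 := pow_le_pow_left₀ (norm_nonneg _) (hB p) 2
      calc 𝔣[ρ, p, q] * 𝟙ᵇ[p, c, R] * ‖h p‖ ^ 2 ≤ 𝔣[ρ, p, q] * 𝟙ᵇ[p, c, R] * B ^ 2 :=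
            mul_le_mul_of_nonneg_left hh2 h0
        _ = B ^ 2 * (𝔣[ρ, p, q] * 𝟙ᵇ[p, c, R]) := by ring

/-- The TAIL family `[p≠q] far(p,q) 𝟙_R(p) ‖h q‖²` is summable on `S × S`. [folklore] -/
theorem summable_farTail (hA : Adm₀ A) (hI : Inner₀ t A) {h : (EuclideanSpace ℝ (Fin 3)) → (EuclideanSpace ℝ (Fin 3))}
    {B : ℝ} (hB : ∀ x, ‖h x‖ ≤ B) (c : (EuclideanSpace ℝ (Fin 3))) (R : ℝ) {ρ : ℝ} (hρ : 23 / 25 ≤ ρ) :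
    Summable (Function.uncurry fun (p q : Sites₀ t A) => (if (p : (EuclideanSpace ℝ (Fin 3))) ≠ q then
      𝔣[ρ, p, q] * 𝟙ᵇ[p, c, R] * ‖h q‖ ^ 2 else 0)) := by
  have hB0 : 0 ≤ B := (norm_nonneg _).trans (hB 0)
  have hW := (summable_farWeight hA hI c R hρ).mul_left (B ^ 2)
  refine Summable.of_nonneg_of_le (fun pq => ?_) (fun pq => ?_) hW
  · obtain ⟨p, q⟩ := pq
    simp only [Function.uncurry_apply_pair]
    split_ifs <;> positivity
  · obtain ⟨p, q⟩ := pq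
    simp only [Function.uncurry_apply_pair]
    by_cases hpq : (p : (EuclideanSpace ℝ (Fin 3))) = q
    · simp [hpq]
    · rw [if_pos hpq, if_pos hpq]
      have h0 : 0 ≤ 𝔣[ρ, p, q] * 𝟙ᵇ[p, c, R] := by
        have : (0 : ℝ) ≤ 𝔣[ρ, p, q] := by split_ifs <;> positivity
        have : (0 : ℝ) ≤ 𝟙ᵇ[p, c, R] := by split_ifs <;> norm_num
        positivity
      have hh2 : ‖h q‖ ^ 2 ≤ B ^ 2 := pow_le_pow_left₀ (norm_nonneg _) (hB q) 2
      calc 𝔣[ρ, p, q] * 𝟙ᵇ[p, c, R] * ‖h q‖ ^ 2 ≤ 𝔣[ρ, p, q] * 𝟙ᵇ[p, c, R] * B ^ 2 :=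
            mul_le_mul_of_nonneg_left hh2 h0
        _ = B ^ 2 * (𝔣[ρ, p, q] * 𝟙ᵇ[p, c, R]) := by ring

/-- The double sum of the far family with the local mass is `≤ F₈(ρ) · M(R)`. [folklore] -/
theorem tsum_tsum_farMass_le (hA : Adm₀ A) (hI : Inner₀ t A) {h : (EuclideanSpace ℝ (Fin 3)) → (EuclideanSpace ℝ (Fin 3))}
    {B : ℝ} (hB : ∀ x, ‖h x‖ ≤ B) (c : (EuclideanSpace ℝ (Fin 3))) (R : ℝ) {ρ : ℝ} (hρ : 23 / 25 ≤ ρ) :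
    (∑' p : Sites₀ t A, ∑' q : Sites₀ t A, (if (p : (EuclideanSpace ℝ (Fin 3))) ≠ q then
      𝔣[ρ, p, q] * 𝟙ᵇ[p, c, R] * ‖h p‖ ^ 2 else 0)) ≤
      1024 / ((23 / 25 : ℝ) ^ 3 * ρ ^ 5) * ∑' p : Sites₀ t A, ‖h p‖ ^ 2 * 𝟙ᵇ[p, c, R] := by
  have hW := summable_farMass hA hI hB c R hρ
  have hloc := summable_normSq_indicator hA hI h c R
  rw [← tsum_mul_left]
  refine hW.prod.tsum_le_tsum (fun p => ?_) (hloc.mul_left _)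
  obtain ⟨hfs, hfle⟩ := summable_far_inv_pow_eight_sites hA hI (p : (EuclideanSpace ℝ (Fin 3))) hρ
  have hrow : (∑' q : Sites₀ t A, (if (p : (EuclideanSpace ℝ (Fin 3))) ≠ q then 𝔣[ρ, p, q] * 𝟙ᵇ[p, c, R] * ‖h p‖ ^ 2 else 0)) ≤
      (∑' q : Sites₀ t A, 𝔣[ρ, q, p]) * (𝟙ᵇ[p, c, R] * ‖h p‖ ^ 2) := by
    rw [← tsum_mul_right]
    refine (hW.prod_factor p).tsum_le_tsum (fun q => ?_) (hfs.mul_right _)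
    have h0 : (0 : ℝ) ≤ 𝟙ᵇ[p, c, R] * ‖h p‖ ^ 2 := by
      have : (0 : ℝ) ≤ 𝟙ᵇ[p, c, R] := by split_ifs <;> norm_num
      positivity
    by_cases hpq : (p : (EuclideanSpace ℝ (Fin 3))) = q
    · simp only [ne_eq, hpq, not_true_eq_false, if_false]
      have : (0 : ℝ) ≤ 𝔣[ρ, q, p] := by split_ifs <;> positivity
      positivity
    · simp only [if_pos hpq, dist_comm (q : (EuclideanSpace ℝ (Fin 3))) p]
      rw [mul_assoc]
  refine hrow.trans ?_
  have h0 : (0 : ℝ) ≤ 𝟙ᵇ[p, c, R] * ‖h p‖ ^ 2 := by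
    have : (0 : ℝ) ≤ 𝟙ᵇ[p, c, R] := by split_ifs <;> norm_num
    positivity
  calc (∑' q : Sites₀ t A, 𝔣[ρ, q, p]) * (𝟙ᵇ[p, c, R] * ‖h p‖ ^ 2)
      ≤ 1024 / ((23 / 25 : ℝ) ^ 3 * ρ ^ 5) * (𝟙ᵇ[p, c, R] * ‖h p‖ ^ 2) := mul_le_mul_of_nonneg_right hfle h0
    _ = 1024 / ((23 / 25 : ℝ) ^ 3 * ρ ^ 5) * (‖h p‖ ^ 2 * 𝟙ᵇ[p, c, R]) := by ring

/-- The swapped far family with the local mass has the same double sum (Fubini). [folklore] -/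
theorem tsum_tsum_farMass'_le (hA : Adm₀ A) (hI : Inner₀ t A) {h : (EuclideanSpace ℝ (Fin 3)) → (EuclideanSpace ℝ (Fin 3))}
    {B : ℝ} (hB : ∀ x, ‖h x‖ ≤ B) (c : (EuclideanSpace ℝ (Fin 3))) (R : ℝ) {ρ : ℝ} (hρ : 23 / 25 ≤ ρ) :
    (∑' p : Sites₀ t A, ∑' q : Sites₀ t A, (if (q : (EuclideanSpace ℝ (Fin 3))) ≠ p then
      𝔣[ρ, q, p] * 𝟙ᵇ[q, c, R] * ‖h q‖ ^ 2 else 0)) ≤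
      1024 / ((23 / 25 : ℝ) ^ 3 * ρ ^ 5) * ∑' p : Sites₀ t A, ‖h p‖ ^ 2 * 𝟙ᵇ[p, c, R] := by
  have hW := summable_farMass hA hI hB c R hρ
  have hW' : Summable (Function.uncurry fun (p q : Sites₀ t A) => (if (q : (EuclideanSpace ℝ (Fin 3))) ≠ p then
      𝔣[ρ, q, p] * 𝟙ᵇ[q, c, R] * ‖h q‖ ^ 2 else 0)) := by
    refine hW.prod_symm.congr fun pq => ?_
    obtain ⟨p, q⟩ := pq
    simp only [Prod.swap_prod_mk, Function.uncurry_apply_pair]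
  rw [← hW'.tsum_comm]
  exact tsum_tsum_farMass_le hA hI hB c R hρ

/-- The swapped tail family has the same double sum as the tail family (Fubini). [folklore] -/
theorem tsum_tsum_farTail'_eq (hA : Adm₀ A) (hI : Inner₀ t A) {h : (EuclideanSpace ℝ (Fin 3)) → (EuclideanSpace ℝ (Fin 3))}
    {B : ℝ} (hB : ∀ x, ‖h x‖ ≤ B) (c : (EuclideanSpace ℝ (Fin 3))) (R : ℝ) {ρ : ℝ} (hρ : 23 / 25 ≤ ρ) :
    (∑' p : Sites₀ t A, ∑' q : Sites₀ t A, (if (q : (EuclideanSpace ℝ (Fin 3))) ≠ p then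
      𝔣[ρ, q, p] * 𝟙ᵇ[q, c, R] * ‖h p‖ ^ 2 else 0)) =
      ∑' p : Sites₀ t A, ∑' q : Sites₀ t A, (if (p : (EuclideanSpace ℝ (Fin 3))) ≠ q then
        𝔣[ρ, p, q] * 𝟙ᵇ[p, c, R] * ‖h q‖ ^ 2 else 0) := by
  have hW := summable_farTail hA hI hB c R hρ
  have hW' : Summable (Function.uncurry fun (p q : Sites₀ t A) => (if (q : (EuclideanSpace ℝ (Fin 3))) ≠ p then
      𝔣[ρ, q, p] * 𝟙ᵇ[q, c, R] * ‖h p‖ ^ 2 else 0)) := by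
    refine hW.prod_symm.congr fun pq => ?_
    obtain ⟨p, q⟩ := pq
    simp only [Prod.swap_prod_mk, Function.uncurry_apply_pair]
  rw [← hW'.tsum_comm]

/-! ## Termwise majorant with the tail -/

/-- Termwise bound for the tail form of the Caccioppoli estimate: the near pairs as in `cutoffTerm_le_local`,
the far pairs through `|h_p||h_q| ≤ (|h_p|² + |h_q|²)/2` instead of the global sup. [folklore] -/
theorem cutoffTerm_le_tail (hA : Adm₀ A) (hI : Inner₀ t A) {h : (EuclideanSpace ℝ (Fin 3)) → (EuclideanSpace ℝ (Fin 3))}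
    {η : (EuclideanSpace ℝ (Fin 3)) → ℝ} (hη0 : ∀ x, 0 ≤ η x) (hη1 : ∀ x, η x ≤ 1)
    {c : (EuclideanSpace ℝ (Fin 3))} {R ρ : ℝ} (hρ : 1 ≤ ρ)
    (hηR : ∀ p : Sites₀ t A, R < dist (p : (EuclideanSpace ℝ (Fin 3))) c → η p = 0)
    (hlip : ∀ p q : Sites₀ t A, |η p - η q| ≤ ‖(p : (EuclideanSpace ℝ (Fin 3))) - q‖ / ρ) (p q : Sites₀ t A) :
    |(if (p : (EuclideanSpace ℝ (Fin 3))) ≠ q then (η p - η q) ^ 2 *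
        ⟪𝕂[(p : (EuclideanSpace ℝ (Fin 3))) - q] (h p), h q⟫ else 0)| ≤
      19 / ρ ^ 2 * ((if (p : (EuclideanSpace ℝ (Fin 3))) ≠ q then (dist (p : (EuclideanSpace ℝ (Fin 3))) q)⁻¹ ^ 6 * (‖h q‖ ^ 2 * 𝟙ᵇ[q, c, R + ρ]) else 0) +
        (if (q : (EuclideanSpace ℝ (Fin 3))) ≠ p then (dist (q : (EuclideanSpace ℝ (Fin 3))) p)⁻¹ ^ 6 * (‖h p‖ ^ 2 * 𝟙ᵇ[p, c, R + ρ]) else 0)) +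
      19 * ((if (p : (EuclideanSpace ℝ (Fin 3))) ≠ q then 𝔣[ρ, p, q] * 𝟙ᵇ[p, c, R] * ‖h p‖ ^ 2 else 0) +
        (if (q : (EuclideanSpace ℝ (Fin 3))) ≠ p then 𝔣[ρ, q, p] * 𝟙ᵇ[q, c, R] * ‖h q‖ ^ 2 else 0) +
        (if (p : (EuclideanSpace ℝ (Fin 3))) ≠ q then 𝔣[ρ, p, q] * 𝟙ᵇ[p, c, R] * ‖h q‖ ^ 2 else 0) +
        (if (q : (EuclideanSpace ℝ (Fin 3))) ≠ p then 𝔣[ρ, q, p] * 𝟙ᵇ[q, c, R] * ‖h p‖ ^ 2 else 0)) := by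
  have hρ0 : 0 < ρ := by linarith
  by_cases hpq : (p : (EuclideanSpace ℝ (Fin 3))) = q
  · simp [hpq]
  · have hqp : (q : (EuclideanSpace ℝ (Fin 3))) ≠ p := fun h' => hpq h'.symm
    rw [if_pos hpq, if_pos hpq, if_pos hqp, if_pos hpq, if_pos hqp, if_pos hpq, if_pos hqp, abs_mul, abs_pow, sq_abs]
    have hd : (23 / 25 : ℝ) ≤ dist (p : (EuclideanSpace ℝ (Fin 3))) q := dist_sites_ge hA hI p.2 q.2 hpq
    have he : 9 / 10 ≤ ‖(p : (EuclideanSpace ℝ (Fin 3))) - q‖ := by rw [← dist_eq_norm]; linarith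
    have hdpos : 0 < dist (p : (EuclideanSpace ℝ (Fin 3))) q := by linarith
    set d := dist (p : (EuclideanSpace ℝ (Fin 3))) q with hdd
    have hnd : ‖(p : (EuclideanSpace ℝ (Fin 3))) - q‖ = d := by rw [hdd, dist_eq_norm]
    have hdqp : dist (q : (EuclideanSpace ℝ (Fin 3))) p = d := by rw [hdd, dist_comm]
    rw [hdqp]
    have hin : |⟪𝕂[(p : (EuclideanSpace ℝ (Fin 3))) - q] (h p), h q⟫| ≤ 38 * (d⁻¹) ^ 8 * ‖h p‖ * ‖h q‖ := by
      have := (abs_real_inner_le_norm _ _).trans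
        (mul_le_mul_of_nonneg_right (norm_forceConst_apply_le he (h p)) (norm_nonneg (h q)))
      rw [hnd] at this
      exact this
    have hIp0 : (0 : ℝ) ≤ 𝟙ᵇ[p, c, R] := by split_ifs <;> norm_num
    have hIq0 : (0 : ℝ) ≤ 𝟙ᵇ[q, c, R] := by split_ifs <;> norm_num
    have hIp0' : (0 : ℝ) ≤ 𝟙ᵇ[p, c, R + ρ] := by split_ifs <;> norm_num
    have hIq0' : (0 : ℝ) ≤ 𝟙ᵇ[q, c, R + ρ] := by split_ifs <;> norm_num
    have hnear0 : 0 ≤ 19 / ρ ^ 2 * ((d⁻¹) ^ 6 * (‖h q‖ ^ 2 * 𝟙ᵇ[q, c, R + ρ]) + (d⁻¹) ^ 6 * (‖h p‖ ^ 2 * 𝟙ᵇ[p, c, R + ρ])) := by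
      positivity
    by_cases hfar : ρ < d
    · -- far pairs: AM–GM instead of the global sup
      rw [if_pos hfar]
      have hind : (η p - η q) ^ 2 ≤ 𝟙ᵇ[p, c, R] + 𝟙ᵇ[q, c, R] := by
        by_cases hp' : dist (p : (EuclideanSpace ℝ (Fin 3))) c ≤ R
        · rw [if_pos hp']
          have h0p := hη0 p; have h1p := hη1 p; have h0q := hη0 q; have h1q := hη1 q
          nlinarith
        · by_cases hq' : dist (q : (EuclideanSpace ℝ (Fin 3))) c ≤ R
          · rw [if_neg hp', if_pos hq']
            have h0p := hη0 p; have h1p := hη1 p; have h0q := hη0 q; have h1q := hη1 q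
            nlinarith
          · rw [if_neg hp', if_neg hq', hηR p (lt_of_not_ge hp'), hηR q (lt_of_not_ge hq')]; norm_num
      have hamgm : ‖h p‖ * ‖h q‖ ≤ (‖h p‖ ^ 2 + ‖h q‖ ^ 2) / 2 := by nlinarith [sq_nonneg (‖h p‖ - ‖h q‖)]
      have h8pos : 0 ≤ (d⁻¹) ^ 8 := by positivity
      calc (η p - η q) ^ 2 * |⟪𝕂[(p : (EuclideanSpace ℝ (Fin 3))) - q] (h p), h q⟫|
          ≤ (𝟙ᵇ[p, c, R] + 𝟙ᵇ[q, c, R]) * (38 * (d⁻¹) ^ 8 * ‖h p‖ * ‖h q‖) :=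
            mul_le_mul hind hin (abs_nonneg _) (by positivity)
        _ = (𝟙ᵇ[p, c, R] + 𝟙ᵇ[q, c, R]) * (38 * (d⁻¹) ^ 8) * (‖h p‖ * ‖h q‖) := by ring
        _ ≤ (𝟙ᵇ[p, c, R] + 𝟙ᵇ[q, c, R]) * (38 * (d⁻¹) ^ 8) * ((‖h p‖ ^ 2 + ‖h q‖ ^ 2) / 2) := by gcongr
        _ = 19 * ((d⁻¹) ^ 8 * 𝟙ᵇ[p, c, R] * ‖h p‖ ^ 2 + (d⁻¹) ^ 8 * 𝟙ᵇ[q, c, R] * ‖h q‖ ^ 2 +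
              (d⁻¹) ^ 8 * 𝟙ᵇ[p, c, R] * ‖h q‖ ^ 2 + (d⁻¹) ^ 8 * 𝟙ᵇ[q, c, R] * ‖h p‖ ^ 2) := by ring
        _ ≤ _ := by linarith
    · -- near pairs: exactly as in `cutoffTerm_le_local`
      rw [if_neg hfar]
      have hdle : d ≤ ρ := le_of_not_gt hfar
      have hfar0 : (0 : ℝ) ≤ 19 * (0 * 𝟙ᵇ[p, c, R] * ‖h p‖ ^ 2 + 0 * 𝟙ᵇ[q, c, R] * ‖h q‖ ^ 2 +
          0 * 𝟙ᵇ[p, c, R] * ‖h q‖ ^ 2 + 0 * 𝟙ᵇ[q, c, R] * ‖h p‖ ^ 2) := by positivity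
      by_cases hηeq : η p = η q
      · rw [hηeq, sub_self]
        have : (0 : ℝ) ^ 2 * |⟪𝕂[(p : (EuclideanSpace ℝ (Fin 3))) - q] (h p), h q⟫| = 0 := by ring
        rw [this]
        linarith
      · have hone : η p ≠ 0 ∨ η q ≠ 0 := by
          by_contra hcon
          push Not at hcon
          exact hηeq (by rw [hcon.1, hcon.2])
        have hnear : dist (p : (EuclideanSpace ℝ (Fin 3))) c ≤ R + ρ ∧ dist (q : (EuclideanSpace ℝ (Fin 3))) c ≤ R + ρ := by
          rcases hone with h1 | h1
          · have hpR : dist (p : (EuclideanSpace ℝ (Fin 3))) c ≤ R := le_of_not_gt fun h' => h1 (hηR p h')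
            refine ⟨by linarith, ?_⟩
            have := dist_triangle (q : (EuclideanSpace ℝ (Fin 3))) p c
            rw [hdqp] at this
            linarith
          · have hqR : dist (q : (EuclideanSpace ℝ (Fin 3))) c ≤ R := le_of_not_gt fun h' => h1 (hηR q h')
            refine ⟨?_, by linarith⟩
            have := dist_triangle (p : (EuclideanSpace ℝ (Fin 3))) q c
            rw [← hdd] at this
            linarith
        rw [if_pos hnear.1, if_pos hnear.2, mul_one, mul_one]
        have hηsq : (η p - η q) ^ 2 ≤ d ^ 2 / ρ ^ 2 := by
          have h1 := hlip p q
          rw [hnd] at h1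
          calc (η p - η q) ^ 2 = |η p - η q| ^ 2 := (sq_abs _).symm
            _ ≤ (d / ρ) ^ 2 := pow_le_pow_left₀ (abs_nonneg _) h1 2
            _ = d ^ 2 / ρ ^ 2 := by rw [div_pow]
        have hd6 : (d⁻¹) ^ 8 * d ^ 2 = (d⁻¹) ^ 6 := by field_simp
        have hprod : (η p - η q) ^ 2 * |⟪𝕂[(p : (EuclideanSpace ℝ (Fin 3))) - q] (h p), h q⟫| ≤
            (d ^ 2 / ρ ^ 2) * (38 * (d⁻¹) ^ 8 * ‖h p‖ * ‖h q‖) :=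
          mul_le_mul hηsq hin (abs_nonneg _) (by positivity)
        have hamgm : ‖h p‖ * ‖h q‖ ≤ (‖h p‖ ^ 2 + ‖h q‖ ^ 2) / 2 := by nlinarith [sq_nonneg (‖h p‖ - ‖h q‖)]
        have h6pos : 0 ≤ (d⁻¹) ^ 6 := by positivity
        calc (η p - η q) ^ 2 * |⟪𝕂[(p : (EuclideanSpace ℝ (Fin 3))) - q] (h p), h q⟫|
            ≤ (d ^ 2 / ρ ^ 2) * (38 * (d⁻¹) ^ 8 * ‖h p‖ * ‖h q‖) := hprod
          _ = 38 / ρ ^ 2 * ((d⁻¹) ^ 8 * d ^ 2) * (‖h p‖ * ‖h q‖) := by ring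
          _ = 38 / ρ ^ 2 * (d⁻¹) ^ 6 * (‖h p‖ * ‖h q‖) := by rw [hd6]
          _ ≤ 38 / ρ ^ 2 * (d⁻¹) ^ 6 * ((‖h p‖ ^ 2 + ‖h q‖ ^ 2) / 2) := by gcongr
          _ = 19 / ρ ^ 2 * ((d⁻¹) ^ 6 * ‖h q‖ ^ 2 + (d⁻¹) ^ 6 * ‖h p‖ ^ 2) := by ring
          _ ≤ _ := by linarith

end

end Summit.AtomisticToContinuum.Crystallization.Theorems.ExcessDecayLiouville

end
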